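import Mathlib.NumberTheory.Padics.PadicNumbers
import Mathlib.Data.Int.WithZero
import Literature.NumberTheory.EllipticCurves.KubertTateFiveKummerValuation
import HarnessLib

/-!
# `5 ∣ ord_p f_T(P)` at the primes `p ∤ mn` for rational points of the Kubert–Tate curve `E_{m,n}`

PROOF-ONLY file (theorems only), topic `NumberTheory/EllipticCurves`; the `ℚ`-valued reading of
`KubertTateFiveKummerValuation` (which is stated for a rank-one valuation `Valuation L ℝ≥0`). For
`E_{m,n} : y² + (n-m)xy - mn²y = x³ - mnx²` over `ℚ` and the Kummer function
`f_T = xy - nx² + n²y` (`div f_T = 5(T) - 5(O)`, `T = (0,0)`):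

* `five_dvd_padicValRat_kummerFn` — **if `p` is a prime with `ord_p m = ord_p n = 0`, then
  `5 ∣ ord_p f_T(x, y)` for every rational point `(x, y) ≠ T` of `E_{m,n}`** (the local triviality of
  the `μ₅`-Kummer class at the primes of good reduction prime to `5`·`mn` AND at `p = 5`, and at the
  primes of `m² - 11mn - n²`; Silverman X.1.1(c), Fisher 2001 §2).

Mathlib's `Rat.padicValuation p : Valuation ℚ ℤᵐ⁰` is pushed into `ℝ≥0` along
`WithZeroMulInt.toNNReal` (base `2`), where `KubertTateKummer.exists_val_kummerFn_eq_pow` applies.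

## References

* [SilvermanAEC2009] J. H. Silverman, *AEC*, 2nd ed., Exercise 10.1(c), Thm. X.1.1(c) (proof).
* [Fisher2001FiveSevenDescent] T. Fisher, JEMS 3 (2001), §2.
-/

noncomputable section

open scoped NNReal
open WithZero

namespace Literature.NumberTheory.EllipticCurves

namespace KubertTateKummer

/-- The `p`-adic valuation of `ℚ` with values in `ℝ≥0` (base `2`): `x ↦ 2^{-ord_p x}`. [folklore] -/
private def padicValNNReal (p : ℕ) [Fact p.Prime] : Valuation ℚ ℝ≥0 :=
  (Rat.padicValuation p).map (WithZeroMulInt.toNNReal (e := 2) two_ne_zero)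
    (WithZeroMulInt.toNNReal_strictMono one_lt_two).monotone

/-- `padicValNNReal p x = 2 ^ (-ord_p x)` for `x ≠ 0`. [folklore] -/
private theorem padicValNNReal_apply (p : ℕ) [Fact p.Prime] {x : ℚ} (hx : x ≠ 0) :
    padicValNNReal p x = (2 : ℝ≥0) ^ (-padicValRat p x) := by
  rw [padicValNNReal, Valuation.map_apply]
  have h1 : Rat.padicValuation p x = exp (-padicValRat p x) := by
    simp [Rat.padicValuation, hx]
  rw [h1, WithZeroMulInt.toNNReal_neg_apply _ (exp_ne_zero)]
  have h2 : WithZero.unzero (exp_ne_zero : exp (-padicValRat p x) ≠ 0) =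
      Multiplicative.ofAdd (-padicValRat p x) := WithZero.unzero_coe _
  rw [h2, toAdd_ofAdd]

/-- A rational number with `ord_p x = 0` is a `p`-adic unit: `padicValNNReal p x = 1`. [folklore] -/
private theorem padicValNNReal_eq_one (p : ℕ) [Fact p.Prime] {x : ℚ} (hx : x ≠ 0)
    (h : padicValRat p x = 0) : padicValNNReal p x = 1 := by
  rw [padicValNNReal_apply p hx, h, neg_zero, zpow_zero]

/-- **`5 ∣ ord_p f_T(x, y)` for `ord_p m = ord_p n = 0`**: at a prime `p` where `m, n` are units, the
value of `f_T = xy - nx² + n²y` at a rational point `(x, y) ≠ (0, 0)` of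
`E_{m,n} : y² + (n-m)xy - mn²y = x³ - mnx²` has `p`-adic order divisible by `5`.
[cite: SilvermanAEC2009, Thm. X.1.1(c) (proof) with Exercise 10.1(c)] -/
theorem five_dvd_padicValRat_kummerFn (p : ℕ) [Fact p.Prime] {m n x y : ℚ} (hm0 : m ≠ 0)
    (hm : padicValRat p m = 0) (hn0 : n ≠ 0) (hn : padicValRat p n = 0)
    (he : y ^ 2 + (n - m) * x * y - m * n ^ 2 * y = x ^ 3 - m * n * x ^ 2) (hT : ¬ (x = 0 ∧ y = 0)) :
    (5 : ℤ) ∣ padicValRat p (x * y - n * x ^ 2 + n ^ 2 * y) := by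
  set w := padicValNNReal p with hw
  have hwm : w m = 1 := padicValNNReal_eq_one p hm0 hm
  have hwn : w n = 1 := padicValNNReal_eq_one p hn0 hn
  obtain ⟨z, hz0, hz⟩ := exists_val_kummerFn_eq_pow w hwm hwn he hT
  have hf0 : x * y - n * x ^ 2 + n ^ 2 * y ≠ 0 := kummerFn_ne_zero_of_ne w hwm hwn he hT
  rw [hw, padicValNNReal_apply p hf0, padicValNNReal_apply p hz0] at hz
  have hz' : (2 : ℝ≥0) ^ (-padicValRat p (x * y - n * x ^ 2 + n ^ 2 * y)) =
      (2 : ℝ≥0) ^ (-padicValRat p z * 5) := by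
    rw [zpow_mul, zpow_ofNat]; exact hz
  have hinj : -padicValRat p (x * y - n * x ^ 2 + n ^ 2 * y) = -padicValRat p z * 5 :=
    zpow_right_injective₀ (a := (2 : ℝ≥0)) (by norm_num) (by norm_num) hz'
  exact ⟨padicValRat p z, by linarith⟩

end KubertTateKummer

end Literature.NumberTheory.EllipticCurves

end
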